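import Mathlib.Data.ZMod.Basic
import Mathlib.Data.Fintype.BigOperators
import Mathlib.Algebra.Order.BigOperators.Group.Finset
import Mathlib.Algebra.BigOperators.Ring.Finset
import Mathlib.Tactic.Ring
import Mathlib.Tactic.Linarith
import Mathlib.Tactic.Positivity
import Mathlib.Tactic.GCongr
import HarnessLib

/-!
# Sampling residues modulo `q` from uniform numbers below `M`: the counting bounds

Topic `Computability/Complexity`, namespace `Literature.Computability.Complexity.ResidueSampling`.
A randomised algorithm with coins `r ∈ {0,1}^*` that needs a uniform vector `v ∈ (ℤ/q)^ι` for a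
modulus `q` that is NOT a power of two (e.g. the random row vector `r ∈ [0, q-1]^{rows}` of Khot's
sub-lattice, J. ACM 52 (2005), §5.2.2, with the modulus `q = 100·#A·D` of
`Literature.Algebra.EuclideanLattices.Khot.khot_gap_instances`) reads `|ι|` blocks of `b` bits as
numbers `Y i < M = 2^b` and reduces them modulo `q` (Arora–Barak 2009, §7.1 footnote / §A.2: coins
versus random numbers). The reduced vector is only NEARLY uniform; this file proves the one-sided
counting estimate that suffices for bounded-error algorithms (bad events at most double), with no
probability theory (pure cardinalities, to be combined with the equal-fibre transfer of
`MetaComplexity/PromiseRandReductionsCounting.lean`):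

* `card_fibre_natCast_le` — each residue class has at most `M / q + 1` representatives below `M`;
* `card_filter_redVec_mem_le`, `card_filter_comp_redVec_le` — for a set `B` of residue vectors,
  `#{Y : ι → Fin M | (Y mod q) ∈ B} ≤ #B · (M / q + 1)^{|ι|}`;
* `add_pow_mul_le`, `add_pow_le_two_mul_pow` — `(M + q)^E ≤ 2 M^E` for `2 E q ≤ M`;
* `mul_card_filter_comp_redVec_le` — **the transfer**: if `k · #B ≤ q^{|ι|}` (the bad residue
  vectors are at most a `1/k` fraction) and `2 |ι| q ≤ M`, then `k · #{Y | (Y mod q) ∈ B} ≤ 2 · M^{|ι|}`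
  (the bad samples are at most a `2/k` fraction);
* `card_filter_prod_redVec_le`, `mul_card_filter_prod_redVec_le` — the same for sample spaces
  `α × [0, M)^ι → α × (ℤ/q)^ι` with a further uniform component `α` left untouched (e.g. Khot's
  tuple of column indices next to the row vector).

## References

* S. Arora, B. Barak, *Computational Complexity: A Modern Approach*, CUP 2009, §7.1 (random bits
  versus random numbers), §A.2.
* D. E. Knuth, *The Art of Computer Programming*, Vol. 2, 3rd ed., 1998, §3.4.1 (uniform integers
  from uniform bits by reduction, and its bias).
-/

namespace Literature.Computability.Complexity.ResidueSampling

open Finset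

section One

variable {M q : ℕ} [NeZero q]

/-- **A residue class modulo `q` has at most `M / q + 1` members below `M`**: the quotient map
`y ↦ y / q` is injective on the class and lands in `[0, M/q]`. [cite: AroraBarak2009, §7.1] -/
theorem card_fibre_natCast_le (s : ZMod q) :
    #{y : Fin M | ((y : ℕ) : ZMod q) = s} ≤ M / q + 1 := by
  have hq : 0 < q := Nat.pos_of_ne_zero (NeZero.ne q)
  -- inject the fibre into `Fin (M / q + 1)` by `y ↦ y / q`
  have hinj : Set.InjOn (fun y : Fin M => (y : ℕ) / q)
      ((univ.filter fun y : Fin M => ((y : ℕ) : ZMod q) = s) : Set (Fin M)) := by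
    intro y hy y' hy' h
    simp only [coe_filter, mem_univ, true_and, Set.mem_setOf_eq] at hy hy'
    have hmod : (y : ℕ) % q = (y' : ℕ) % q := by
      have h1 := (ZMod.natCast_eq_natCast_iff' (y : ℕ) (y' : ℕ) q).1 (hy.trans hy'.symm)
      exact h1
    have h' : (y : ℕ) / q = (y' : ℕ) / q := h
    apply Fin.ext
    rw [← Nat.div_add_mod (y : ℕ) q, ← Nat.div_add_mod (y' : ℕ) q, h', hmod]
  have hmaps : ∀ y ∈ univ.filter (fun y : Fin M => ((y : ℕ) : ZMod q) = s),
      (fun y : Fin M => (y : ℕ) / q) y ∈ range (M / q + 1) := by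
    intro y _
    simp only [mem_range]
    exact Nat.lt_succ_of_le (Nat.div_le_div_right y.2.le)
  calc #{y : Fin M | ((y : ℕ) : ZMod q) = s}
      ≤ #(range (M / q + 1)) := card_le_card_of_injOn _ hmaps hinj
    _ = M / q + 1 := card_range _

end One

section Many

variable {ι : Type} [Fintype ι] [DecidableEq ι] {M q : ℕ} [NeZero q]

/-- The coordinatewise reduction of a vector of numbers below `M` to residues modulo `q`.
[cite: AroraBarak2009, §7.1] -/
def redVec (Y : ι → Fin M) : ι → ZMod q := fun i => ((Y i : ℕ) : ZMod q)

/-- The fibre of a residue vector under `redVec` is the product of the coordinate fibres, so it has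
at most `(M / q + 1)^{|ι|}` elements. [cite: AroraBarak2009, §A.2] -/
theorem card_fibre_redVec_le (v : ι → ZMod q) :
    #{Y : ι → Fin M | redVec (q := q) Y = v} ≤ (M / q + 1) ^ Fintype.card ι := by
  classical
  have hsub : (univ.filter fun Y : ι → Fin M => redVec (q := q) Y = v) ⊆
      Fintype.piFinset fun i => univ.filter fun y : Fin M => ((y : ℕ) : ZMod q) = v i := by
    intro Y hY
    simp only [mem_filter, mem_univ, true_and] at hY
    refine Fintype.mem_piFinset.2 fun i => ?_
    simp only [mem_filter, mem_univ, true_and]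
    exact congrFun hY i
  calc #{Y : ι → Fin M | redVec (q := q) Y = v}
      ≤ #(Fintype.piFinset fun i => univ.filter fun y : Fin M => ((y : ℕ) : ZMod q) = v i) :=
        card_le_card hsub
    _ = ∏ i, #{y : Fin M | ((y : ℕ) : ZMod q) = v i} := Fintype.card_piFinset _
    _ ≤ ∏ _i : ι, (M / q + 1) := prod_le_prod' fun i _ => card_fibre_natCast_le (v i)
    _ = (M / q + 1) ^ Fintype.card ι := by rw [prod_const, card_univ]

/-- **Counting samples that reduce into a given set of residue vectors**:
`#{Y : ι → Fin M | redVec Y ∈ B} ≤ #B · (M / q + 1)^{|ι|}`. [cite: AroraBarak2009, §A.2] -/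
theorem card_filter_redVec_mem_le (B : Finset (ι → ZMod q)) :
    #{Y : ι → Fin M | redVec (q := q) Y ∈ B} ≤ #B * (M / q + 1) ^ Fintype.card ι := by
  classical
  have hcover : (univ.filter fun Y : ι → Fin M => redVec (q := q) Y ∈ B) ⊆
      B.biUnion fun v => univ.filter fun Y : ι → Fin M => redVec (q := q) Y = v := by
    intro Y hY
    simp only [mem_filter, mem_univ, true_and] at hY
    exact mem_biUnion.2 ⟨_, hY, mem_filter.2 ⟨mem_univ _, rfl⟩⟩
  calc #{Y : ι → Fin M | redVec (q := q) Y ∈ B}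
      ≤ #(B.biUnion fun v => univ.filter fun Y : ι → Fin M => redVec (q := q) Y = v) := card_le_card hcover
    _ ≤ ∑ v ∈ B, #{Y : ι → Fin M | redVec (q := q) Y = v} := card_biUnion_le
    _ ≤ ∑ _v ∈ B, (M / q + 1) ^ Fintype.card ι := sum_le_sum fun v _ => card_fibre_redVec_le v
    _ = #B * (M / q + 1) ^ Fintype.card ι := by rw [sum_const, smul_eq_mul]

/-- The same for a set given by a predicate on residue vectors. [cite: AroraBarak2009, §A.2] -/
theorem card_filter_comp_redVec_le (P : (ι → ZMod q) → Prop) [DecidablePred P] :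
    #{Y : ι → Fin M | P (redVec (q := q) Y)} ≤ #{v : ι → ZMod q | P v} * (M / q + 1) ^ Fintype.card ι := by
  classical
  have h := card_filter_redVec_mem_le (M := M) (univ.filter fun v : ι → ZMod q => P v)
  refine le_trans (le_of_eq ?_) h
  congr 1
  ext Y
  simp

end Many

/-! ### `(M + q)^E ≤ 2 M^E` for `2 E q ≤ M` -/

/-- `(a + q)^E · a ≤ a^E · (a + 2 E q)` for `2 E q ≤ a` (i.e. `(1 + q/a)^E ≤ 1 + 2Eq/a`).
[folklore] -/
theorem add_pow_mul_le (a q : ℕ) : ∀ E : ℕ, 2 * E * q ≤ a → (a + q) ^ E * a ≤ a ^ E * (a + 2 * E * q)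
  | 0, _ => by simp
  | E + 1, h => by
    have ih := add_pow_mul_le a q E (le_trans (by nlinarith) h)
    have hq : 2 * E * q * q ≤ q * a := by
      have : 2 * E * q ≤ a := le_trans (by nlinarith) h
      calc 2 * E * q * q = q * (2 * E * q) := by ring
        _ ≤ q * a := Nat.mul_le_mul_left q this
    calc (a + q) ^ (E + 1) * a = (a + q) * ((a + q) ^ E * a) := by ring
      _ ≤ (a + q) * (a ^ E * (a + 2 * E * q)) := Nat.mul_le_mul_left _ ih
      _ = a ^ E * (a * a + 2 * E * q * a + q * a + 2 * E * q * q) := by ring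
      _ ≤ a ^ E * (a * a + 2 * E * q * a + q * a + q * a) := by gcongr
      _ = a ^ (E + 1) * (a + 2 * (E + 1) * q) := by ring

/-- `(a + q)^E ≤ 2 a^E` for `2 E q ≤ a` (for `a = 0` the hypothesis forces `q = 0` or `E = 0`).
[folklore] -/
theorem add_pow_le_two_mul_pow {a q E : ℕ} (h : 2 * E * q ≤ a) : (a + q) ^ E ≤ 2 * a ^ E := by
  rcases Nat.eq_zero_or_pos E with rfl | hE
  · simp
  rcases Nat.eq_zero_or_pos a with rfl | ha
  · have hq : q = 0 := by
      rcases Nat.eq_zero_or_pos q with hq | hq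
      · exact hq
      · nlinarith
    subst hq
    simp [Nat.pos_iff_ne_zero.1 hE]
  have h1 := add_pow_mul_le a q E h
  have h2 : a ^ E * (a + 2 * E * q) ≤ (2 * a ^ E) * a := by
    calc a ^ E * (a + 2 * E * q) ≤ a ^ E * (a + a) := Nat.mul_le_mul_left _ (by omega)
      _ = (2 * a ^ E) * a := by ring
  exact Nat.le_of_mul_le_mul_right (h1.trans h2) ha

/-! ### The transfer of a bad-fraction bound -/

section Transfer

variable {ι : Type} [Fintype ι] [DecidableEq ι] {M q : ℕ} [NeZero q]

/-- **Reduction modulo `q` at most doubles the fraction of bad outcomes.** If the bad residue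
vectors are at most a `1/k` fraction of `(ℤ/q)^ι` (`k · #{v | B v} ≤ q^{|ι|}`) and the samples are
long enough (`2 |ι| q ≤ M`), then the samples `Y ∈ [0, M)^ι` reducing to a bad vector are at most a
`2/k` fraction: `k · #{Y | B (redVec Y)} ≤ 2 · M^{|ι|}` (`= 2 · |[0,M)^ι|`).
[cite: AroraBarak2009, §7.1 and §A.2] -/
theorem mul_card_filter_comp_redVec_le (B : (ι → ZMod q) → Prop) [DecidablePred B] {k : ℕ}
    (hk : k * #{v : ι → ZMod q | B v} ≤ q ^ Fintype.card ι) (hM : 2 * Fintype.card ι * q ≤ M) :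
    k * #{Y : ι → Fin M | B (redVec (q := q) Y)} ≤ 2 * M ^ Fintype.card ι := by
  set E := Fintype.card ι
  have h1 := card_filter_comp_redVec_le (M := M) (q := q) B
  -- `(M/q + 1)^E · q^E ≤ (M + q)^E`
  have h2 : (M / q + 1) ^ E * q ^ E ≤ (M + q) ^ E := by
    rw [← mul_pow]
    refine Nat.pow_le_pow_left ?_ E
    have := Nat.div_mul_le_self M q
    nlinarith
  have h3 : (M + q) ^ E ≤ 2 * M ^ E := add_pow_le_two_mul_pow hM
  -- combine: k·#bad ≤ k·#B·(M/q+1)^E ≤ q^E (M/q+1)^E / … — multiply `hk` by `(M/q+1)^E`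
  calc k * #{Y : ι → Fin M | B (redVec (q := q) Y)}
      ≤ k * (#{v : ι → ZMod q | B v} * (M / q + 1) ^ E) := Nat.mul_le_mul_left k h1
    _ = (k * #{v : ι → ZMod q | B v}) * (M / q + 1) ^ E := by ring
    _ ≤ q ^ E * (M / q + 1) ^ E := Nat.mul_le_mul_right _ hk
    _ = (M / q + 1) ^ E * q ^ E := by ring
    _ ≤ (M + q) ^ E := h2
    _ ≤ 2 * M ^ E := h3

end Transfer

/-! ### A further exactly-uniform component -/

section Prod

variable {α ι : Type} [Fintype α] [DecidableEq α] [Fintype ι] [DecidableEq ι] {M q : ℕ} [NeZero q]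

/-- Counting over a product by the first coordinate. [folklore] -/
theorem card_filter_prod_eq_sum_fst {β : Type} [Fintype β] (P : α × β → Prop) [DecidablePred P] :
    #{p : α × β | P p} = ∑ a, #{b : β | P (a, b)} := by
  classical
  rw [card_eq_sum_card_fiberwise (f := Prod.fst) (s := univ.filter fun p : α × β => P p) (t := univ)
    (fun _ _ => mem_univ _)]
  refine sum_congr rfl fun a _ => ?_
  refine card_bij (fun p _ => p.2) (fun p hp => ?_) (fun p₁ hp₁ p₂ hp₂ h => ?_) (fun b hb => ?_)
  · simp only [mem_filter, mem_univ, true_and] at hp ⊢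
    obtain ⟨hP, rfl⟩ := hp
    exact hP
  · simp only [mem_filter, mem_univ, true_and] at hp₁ hp₂
    exact Prod.ext (hp₁.2.trans hp₂.2.symm) h
  · simp only [mem_filter, mem_univ, true_and] at hb
    exact ⟨(a, b), by simp [hb], rfl⟩

/-- **Product form of the counting bound**: for an event on `α × (ℤ/q)^ι`,
`#{(a, Y) | P (a, redVec Y)} ≤ #{(a, v) | P (a, v)} · (M / q + 1)^{|ι|}`. [cite: AroraBarak2009, §A.2] -/
theorem card_filter_prod_redVec_le (P : α × (ι → ZMod q) → Prop) [DecidablePred P] :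
    #{p : α × (ι → Fin M) | P (p.1, redVec (q := q) p.2)} ≤
      #{ω : α × (ι → ZMod q) | P ω} * (M / q + 1) ^ Fintype.card ι := by
  classical
  rw [card_filter_prod_eq_sum_fst (fun p : α × (ι → Fin M) => P (p.1, redVec (q := q) p.2)),
    card_filter_prod_eq_sum_fst P, Finset.sum_mul]
  exact sum_le_sum fun a _ => card_filter_comp_redVec_le (M := M) (q := q) fun v => P (a, v)

/-- **Product form of the transfer**: if the bad outcomes are at most a `1/k` fraction of
`α × (ℤ/q)^ι` (`k · #bad ≤ |α| · q^{|ι|}`) and `2 |ι| q ≤ M`, then the bad samples are at most a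
`2/k` fraction of `α × [0, M)^ι` (`k · #bad ≤ 2 · |α| · M^{|ι|}`). [cite: AroraBarak2009, §7.1 and §A.2] -/
theorem mul_card_filter_prod_redVec_le (B : α × (ι → ZMod q) → Prop) [DecidablePred B] {k : ℕ}
    (hk : k * #{ω : α × (ι → ZMod q) | B ω} ≤ Fintype.card α * q ^ Fintype.card ι)
    (hM : 2 * Fintype.card ι * q ≤ M) :
    k * #{p : α × (ι → Fin M) | B (p.1, redVec (q := q) p.2)} ≤
      2 * (Fintype.card α * M ^ Fintype.card ι) := by
  set E := Fintype.card ι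
  have h1 := card_filter_prod_redVec_le (M := M) (q := q) B
  have h2 : (M / q + 1) ^ E * q ^ E ≤ (M + q) ^ E := by
    rw [← mul_pow]
    refine Nat.pow_le_pow_left ?_ E
    have := Nat.div_mul_le_self M q
    nlinarith
  have h3 : (M + q) ^ E ≤ 2 * M ^ E := add_pow_le_two_mul_pow hM
  calc k * #{p : α × (ι → Fin M) | B (p.1, redVec (q := q) p.2)}
      ≤ k * (#{ω : α × (ι → ZMod q) | B ω} * (M / q + 1) ^ E) := Nat.mul_le_mul_left k h1
    _ = (k * #{ω : α × (ι → ZMod q) | B ω}) * (M / q + 1) ^ E := by ring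
    _ ≤ (Fintype.card α * q ^ E) * (M / q + 1) ^ E := Nat.mul_le_mul_right _ hk
    _ = Fintype.card α * ((M / q + 1) ^ E * q ^ E) := by ring
    _ ≤ Fintype.card α * (M + q) ^ E := Nat.mul_le_mul_left _ h2
    _ ≤ Fintype.card α * (2 * M ^ E) := Nat.mul_le_mul_left _ h3
    _ = 2 * (Fintype.card α * M ^ E) := by ring

end Prod

end Literature.Computability.Complexity.ResidueSampling
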